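import Summits.QuantumFields.BalabanUV.Beta.D1BFx.GhostHalfCovariant
import Summits.QuantumFields.BalabanUV.Beta.D1BFx.TorusGhostSideZero

/-!
# `BalabanUV.Beta.D1BFx.TorusGhostSideHalf` — road «BF-x» for binder row D1, slot (K), brick **«TB5-2c-D′»: THE ROAD INSTANCE OF
# `GhostHalfCovariant` (F-g7-2 ∕ ruling ρ-g7-5, `K-END-RECUT-SPEC.md` v1 §4) — ON EVERY TORUS OF THE K-TB3b-J FAMILY THE EXACT GHOST SIDE OF
# ROUTE T UNDER (R2) IS `2·h[(m+1)²•Ĝ′; half-covariant words] + 2·h[(m+1)⁻⁸•Ĉsq; S̃-words] − h[(m+1)⁻⁸•Ĉsq; S-words]`, ALL LEGS TYPED**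

HONEST FRAMING (cell contract, verbatim): «discharging `BetaPertH` makes Bałaban's UV stability UNCONDITIONAL — a real constructive-QFT
result; it is NOT the continuum limit and NOT the Clay problem.»  HONEST DEPENDENCY (verbatim): «continuum YM on T⁴ ⇐ BetaPertH ∧ nine
spine estimates (0/9 proved); BetaPertH ⇐ (D1) ∧ (D4) ∧ CAP+tail; G-an2-4 gates asym, D1 and NE2/3/4.»  THIS MODULE DISCHARGES NOTHING of
D1 / BetaPertH / the «BF-x» wall: it is [folklore] finite matrix algebra BY NAME — ONE application of the road owner's model theorem
`GhostHalfCovariant.hessT_ghost_halfCovariant` (p244989) at the road's data, with its seven hypotheses discharged and its three inverse letters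
read as the road's periodised legs by this lineage's K-TB3c modules.  No `def`, no `def … : Prop`, nothing cited, 0 sorry.  NOT summit
progress; NOT BetaPertH, NOT continuum, NOT Clay.

ABSOLUTE RULE (cell, verbatim): «No internally-minted statement may enter as a cited fact. Every hypothesis is either kernel-proved in this
package or a verbatim quotation of a PUBLISHED theorem with page reference. The manuscript(s) under audit are NOT citable for their own
disputed steps — they are the thing under adjudication; programme-internal (2001/route/tribunal) claims are never citable.»

THE INSTANCE.  Fine torus `Λ_s`, `s = (m+1)·p` (pv23 blocks of side `m+1`, `p⁴` of them), leg parameter `a > 0`, basis parameter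
`r ∈ box 4 (m+1)` (K-TB3b-N).  Model data ↦ road data: `D₀ := D̂ₛ = TorusHodgeWeight.DhatS m p` (the torus gradient with bonds sorted by `e₁`,
`D̂ₛᵀD̂ₛ = L̂`), ARBITRARY gradient jets `Dₛ Dₜ Dₛₜ : I 3 (m+1) p × Λ_s` (two-parameter background family — on the road they are the jets of the
covariant gradient `D_U`, supplied by TB4-W), `Q := Qind m s p` (block indicator, `TorusScalarAveraging`), `N := N̂ = Nhat r (m+1) p` (K-TB3b-N basis of
`ker Q̂ = ker Ŝ`), `Γ := 1`, `c := a/(m+1)⁶`.  Then (`§1`) the model's tower letter is `M₀ = L̂ + (a/(m+1)⁶)•QindᵀQind = (m+1)⁻²•ÂX`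
(`PeriodisedProjector.AXhat_eq`, `Qind_transpose_mul_Qind`), so `M₀⁻¹ = (m+1)²•Ĝ′`, `(M₀M₀)⁻¹ = (m+1)⁴•Ĝ′Ĝ′` (`Ghat_mul_AXhat`), the coarse letter is
`Q(M₀M₀)⁻¹Qᵀ = (m+1)⁸•k̂erSq` (`TorusScalarCoarseGram.Qind_Ghat_Ghat_Qind_transpose`) with inverse `(m+1)⁻⁸•Ĉsq` (`kerSqHat_mul_CsqHat`); the seven
hypotheses are `Qind·N̂ = 0` (`TorusGhostSideZero.Qind_mul_eq_zero_of_range` + `Nhat_range`), `det (Qind Qindᵀ) ≠ 0`, `det (N̂ᵀN̂) ≠ 0` (`Nhat_injective`),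
`|ρ| + |Λ_p| = |Λ_s|` (`card_basis_add_card_coarse`), `IsUnit det (N̂ᵀL̂L̂N̂)` (`junction_Nhat`), `IsUnit det M₀`, `IsUnit det (Q(M₀M₀)⁻¹Qᵀ)` (the letters).

MAIN THEOREM `hessT_ghost_side_half`: with the (R2) co-frame∕weight words of the model written at `D₀ = D̂ₛ`, `L₀ = L̂` — `T₀ = N̂ᵀL̂D̂ₛᵀ`
(= TB5-0's `T₀`), `Tₛ = N̂ᵀ(L_sD̂ₛᵀ + L̂Dₛᵀ)`, …, `G₀ = N̂ᵀL̂L̂N̂`, `A₀ = 2•G₀⁻¹`, `Aₛ = −2•G₀⁻¹G_sG₀⁻¹`, …, `Ŵ₀ = D̂ₛN̂` — TB5-1's FP-Gram functional equals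
`2·hessT ((m+1)²•Ĝ′) (DₛᵀD̂ₛ) (DₜᵀD̂ₛ) (DₛₜᵀD̂ₛ) + 2·hessT ((m+1)⁻⁸•Ĉsq) (S̃-words) − hessT ((m+1)⁻⁸•Ĉsq) (S-words)`, the `S̃`∕`S`-words being those of
`GhostSplitJetsProd.hessT_kkt_prod_jets` with `(M₀M₀)⁻¹ ↦ (m+1)⁴•Ĝ′Ĝ′` and `M₀ ↦ (m+1)⁻²•ÂX` — every leg a real multiple of a PERIODISED KERNEL of
K-TB3c (`Ĝ′ = (Ggh)^` per `TorusGhostLegs`, `Ĉsq = (CsqK)^` per `TorusGhostGram`, `× Unit` bridges in `TorusScalarCoarseGram` §3), so the `p → ∞`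
limits are the EXISTING sockets `tendsto_hessT_Ggh` ∕ `tendsto_hessT_CsqK` once the jets are written as arrays (TB4-W, `TorusScalarCoarseArrays`∕`Bubble`).
The scalar prefactors move onto the jets if wanted (`hessT (c•A) V V′ W = hessT A (c•V) (c•V′) (c•W)`, cf. `TorusScalarCoarseArrays.hessT_sandwich_smul`).
One `set_option maxHeartbeats 400000 in`: the single application of the model theorem unifies seven hypothesis types over the road's concrete
index types (`Site 4 ((m+1)p)`, `CombRows`, `I 3 (m+1) p`) and measures ≈ 2× the default budget; nothing is computed by `decide`.

NOT HERE (honest): the `U`-dependence of the jets (TB4-W supplies `Dₛ Dₜ Dₛₜ` as the covariant-gradient jets and their array form); the A-rows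
(«HALF-WORD ROWS», «COARSE-2S̃−S», K-END-RECUT-SPEC §3); the re-cut END; TB5-3's limit bookkeeping.  Bookkeeping toward ONE structural slot of ONE
road for ONE of four binders; 0∕4 binders discharged.

Unit `b2b-balaban-t4-ne9-formalise-leaf-02` (gen 26; cross-row kernel duty on road «BF-x» slot (K) per the NE9 typer's LEAVES v3.0:
row NE9 is WALLED ON A MODEL with the claimable set empty).
-/

noncomputable section

namespace Summit.QuantumFields.BalabanUV.Beta.D1BFx.TorusGhostSideHalf

open Matrix
open Literature.MathematicalPhysics.QuantumFieldTheory.Balaban1983to89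
open Literature.MathematicalPhysics.QuantumFieldTheory.Balaban1983to89.Beta
open Literature.MathematicalPhysics.QuantumFieldTheory.Balaban1983to89.Beta.Composition (kkt)
open Summit.QuantumFields.BalabanUV.Beta.D1BFx.MixedVarPackedHess (hessT)
open Summit.QuantumFields.BalabanUV.Beta.D1BFx.GramWeightJets (gram₀ gram₁)
open Summit.QuantumFields.BalabanUV.Beta.D1BFx.GramWeightJetsMixed (gramMix)
open Summit.QuantumFields.BalabanUV.Beta.D1BFx.GhostHalfCovariant (hessT_ghost_halfCovariant)
open Summit.QuantumFields.BalabanUV.Beta.D1BFx.PeriodisedProjector (Ghat AXhat Lhat Shat Ghat_mul_AXhat AXhat_eq)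
open Summit.QuantumFields.BalabanUV.Beta.D1BFx.TorusScalarAveraging (Qind Qind_transpose_mul_Qind det_Qind_mul_Qind_transpose_ne_zero)
open Summit.QuantumFields.BalabanUV.Beta.D1BFx.TorusScalarCoarseGram (kerSqHat CsqHat Qind_Ghat_Ghat_Qind_transpose kerSqHat_mul_CsqHat)
open Summit.QuantumFields.BalabanUV.Beta.D1BFx.TorusGhostSideZero (det_gram_ne_zero_of_injective Qind_mul_eq_zero_of_range card_basis_add_card_coarse)
open AffineAveraging (box toSite)
open Summit.QuantumFields.BalabanUV.Beta.D1BFx.TorusCombKKT (I CombRows)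
open Summit.QuantumFields.BalabanUV.Beta.D1BFx.TorusGaugeBasisMatrix (Nhat)
open Summit.QuantumFields.BalabanUV.Beta.D1BFx.TorusGaugeBasisKernel (Nhat_range Nhat_injective junction_Nhat)
open Summit.QuantumFields.BalabanUV.Beta.D1BFx.TorusHodgeWeight (DhatS DhatS_transpose_mul_DhatS)

variable (m : ℕ) {a : ℝ} (p : ℕ) [NeZero p]

set_option maxHeartbeats 400000 in
/-- [folklore] **«TB5-2c-D′» — THE ROAD INSTANCE OF F-g7-2: on the torus `Λ_{(m+1)p}` with leg parameter `a > 0` and K-TB3b-N basis `N̂ = Nhat r (m+1) p`,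
TB5-1's FP-Gram functional of the (R2) co-frame∕weight built from the sorted torus gradient `D̂ₛ = DhatS m p` and ARBITRARY gradient jets `Dₛ Dₜ Dₛₜ`
(words displayed: `T₀ = N̂ᵀL̂D̂ₛᵀ`, `G₀ = N̂ᵀL̂L̂N̂`, `A₀ = 2•G₀⁻¹`, …, `Ŵ₀ = D̂ₛN̂`) equals
`2·hessT ((m+1)²•Ĝ′) (DₛᵀD̂ₛ) (DₜᵀD̂ₛ) (DₛₜᵀD̂ₛ) + 2·hessT ((m+1)⁻⁸•Ĉsq) (S̃•) − hessT ((m+1)⁻⁸•Ĉsq) (S•)` — the half-covariant tower on the typed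
leg `Ĝ′ = ÂX⁻¹` plus `2S̃ − S` on the typed coarse leg `Ĉsq`, the `S̃`∕`S`-words being the product-split words of `GhostSplitJetsProd` with
`(M₀M₀)⁻¹ = (m+1)⁴•Ĝ′Ĝ′`, `M₀ = (m+1)⁻²•ÂX`, `Q = Qind`.  (`GhostHalfCovariant.hessT_ghost_halfCovariant` at `D₀ := D̂ₛ`, `Q := Qind`, `N := N̂`,
`Γ := 1`, `c := a/(m+1)⁶`, all seven hypotheses discharged.) -/
theorem hessT_ghost_side_half {r : Fin (3 + 1) → ℕ} (ha : 0 < a) (hr : r ∈ box (3 + 1) (m + 1))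
    (Dₛ Dₜ Dₛₜ : Matrix (I 3 (m + 1) p) (Site 4 ((m + 1) * p)) ℝ) :
    hessT ((DhatS m p * Nhat r (m + 1) p)ᵀ * (((Nhat r (m + 1) p)ᵀ * Lhat ((m + 1) * p) * (DhatS m p)ᵀ)ᵀ * ((2 : ℝ) • ((Nhat r (m + 1) p)ᵀ * (Lhat ((m + 1) * p) * Lhat ((m + 1) * p)) * Nhat r (m + 1) p)⁻¹) * ((Nhat r (m + 1) p)ᵀ * Lhat ((m + 1) * p) * (DhatS m p)ᵀ)) * (DhatS m p * Nhat r (m + 1) p))⁻¹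
        ((DhatS m p * Nhat r (m + 1) p)ᵀ * gram₁ ((Nhat r (m + 1) p)ᵀ * Lhat ((m + 1) * p) * (DhatS m p)ᵀ) ((Nhat r (m + 1) p)ᵀ * ((Dₛᵀ * DhatS m p + (DhatS m p)ᵀ * Dₛ) * (DhatS m p)ᵀ + Lhat ((m + 1) * p) * Dₛᵀ)) ((2 : ℝ) • ((Nhat r (m + 1) p)ᵀ * (Lhat ((m + 1) * p) * Lhat ((m + 1) * p)) * Nhat r (m + 1) p)⁻¹) (-((2 : ℝ) • (((Nhat r (m + 1) p)ᵀ * (Lhat ((m + 1) * p) * Lhat ((m + 1) * p)) * Nhat r (m + 1) p)⁻¹ * ((Nhat r (m + 1) p)ᵀ * ((Dₛᵀ * DhatS m p + (DhatS m p)ᵀ * Dₛ) * Lhat ((m + 1) * p) + Lhat ((m + 1) * p) * (Dₛᵀ * DhatS m p + (DhatS m p)ᵀ * Dₛ)) * Nhat r (m + 1) p) * ((Nhat r (m + 1) p)ᵀ * (Lhat ((m + 1) * p) * Lhat ((m + 1) * p)) * Nhat r (m + 1) p)⁻¹))) * (DhatS m p * Nhat r (m + 1) p))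
        ((DhatS m p * Nhat r (m + 1) p)ᵀ * gram₁ ((Nhat r (m + 1) p)ᵀ * Lhat ((m + 1) * p) * (DhatS m p)ᵀ) ((Nhat r (m + 1) p)ᵀ * ((Dₜᵀ * DhatS m p + (DhatS m p)ᵀ * Dₜ) * (DhatS m p)ᵀ + Lhat ((m + 1) * p) * Dₜᵀ)) ((2 : ℝ) • ((Nhat r (m + 1) p)ᵀ * (Lhat ((m + 1) * p) * Lhat ((m + 1) * p)) * Nhat r (m + 1) p)⁻¹) (-((2 : ℝ) • (((Nhat r (m + 1) p)ᵀ * (Lhat ((m + 1) * p) * Lhat ((m + 1) * p)) * Nhat r (m + 1) p)⁻¹ * ((Nhat r (m + 1) p)ᵀ * ((Dₜᵀ * DhatS m p + (DhatS m p)ᵀ * Dₜ) * Lhat ((m + 1) * p) + Lhat ((m + 1) * p) * (Dₜᵀ * DhatS m p + (DhatS m p)ᵀ * Dₜ)) * Nhat r (m + 1) p) * ((Nhat r (m + 1) p)ᵀ * (Lhat ((m + 1) * p) * Lhat ((m + 1) * p)) * Nhat r (m + 1) p)⁻¹))) * (DhatS m p * Nhat r (m + 1) p))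
        ((DhatS m p * Nhat r (m + 1) p)ᵀ * gramMix ((Nhat r (m + 1) p)ᵀ * Lhat ((m + 1) * p) * (DhatS m p)ᵀ) ((Nhat r (m + 1) p)ᵀ * ((Dₛᵀ * DhatS m p + (DhatS m p)ᵀ * Dₛ) * (DhatS m p)ᵀ + Lhat ((m + 1) * p) * Dₛᵀ)) ((Nhat r (m + 1) p)ᵀ * ((Dₜᵀ * DhatS m p + (DhatS m p)ᵀ * Dₜ) * (DhatS m p)ᵀ + Lhat ((m + 1) * p) * Dₜᵀ)) ((Nhat r (m + 1) p)ᵀ * ((Dₛₜᵀ * DhatS m p + Dₛᵀ * Dₜ + Dₜᵀ * Dₛ + (DhatS m p)ᵀ * Dₛₜ) * (DhatS m p)ᵀ + (Dₛᵀ * DhatS m p + (DhatS m p)ᵀ * Dₛ) * Dₜᵀ + (Dₜᵀ * DhatS m p + (DhatS m p)ᵀ * Dₜ) * Dₛᵀ + Lhat ((m + 1) * p) * Dₛₜᵀ)) ((2 : ℝ) • ((Nhat r (m + 1) p)ᵀ * (Lhat ((m + 1) * p) * Lhat ((m + 1) * p)) * Nhat r (m + 1) p)⁻¹) (-((2 :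 ℝ) • (((Nhat r (m + 1) p)ᵀ * (Lhat ((m + 1) * p) * Lhat ((m + 1) * p)) * Nhat r (m + 1) p)⁻¹ * ((Nhat r (m + 1) p)ᵀ * ((Dₛᵀ * DhatS m p + (DhatS m p)ᵀ * Dₛ) * Lhat ((m + 1) * p) + Lhat ((m + 1) * p) * (Dₛᵀ * DhatS m p + (DhatS m p)ᵀ * Dₛ)) * Nhat r (m + 1) p) * ((Nhat r (m + 1) p)ᵀ * (Lhat ((m + 1) * p) * Lhat ((m + 1) * p)) * Nhat r (m + 1) p)⁻¹))) (-((2 : ℝ) • (((Nhat r (m + 1) p)ᵀ * (Lhat ((m + 1) * p) * Lhat ((m + 1) * p)) * Nhat r (m + 1) p)⁻¹ * ((Nhat r (m + 1) p)ᵀ * ((Dₜᵀ * DhatS m p + (DhatS m p)ᵀ * Dₜ) * Lhat ((m + 1) * p) + Lhat ((m + 1) * p) * (Dₜᵀ * DhatS m p + (DhatS m p)ᵀ * Dₜ)) * Nhat r (m + 1) p) * ((Nhat r (m + 1) p)ᵀ * (Lhat ((m + 1) * p) * Lhat ((m + 1) * p)) * Nhat r (m + 1) p)⁻¹))) ((2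 : ℝ) • (-(((Nhat r (m + 1) p)ᵀ * (Lhat ((m + 1) * p) * Lhat ((m + 1) * p)) * Nhat r (m + 1) p)⁻¹ * ((Nhat r (m + 1) p)ᵀ * ((Dₛₜᵀ * DhatS m p + Dₛᵀ * Dₜ + Dₜᵀ * Dₛ + (DhatS m p)ᵀ * Dₛₜ) * Lhat ((m + 1) * p) + (Dₛᵀ * DhatS m p + (DhatS m p)ᵀ * Dₛ) * (Dₜᵀ * DhatS m p + (DhatS m p)ᵀ * Dₜ) + (Dₜᵀ * DhatS m p + (DhatS m p)ᵀ * Dₜ) * (Dₛᵀ * DhatS m p + (DhatS m p)ᵀ * Dₛ) + Lhat ((m + 1) * p) * (Dₛₜᵀ * DhatS m p + Dₛᵀ * Dₜ + Dₜᵀ * Dₛ + (DhatS m p)ᵀ * Dₛₜ)) * Nhat r (m + 1) p) * ((Nhat r (m + 1) p)ᵀ * (Lhat ((m + 1) * p) * Lhat ((m + 1) * p)) * Nhat r (m + 1) p)⁻¹) + ((Nhat r (m + 1) p)ᵀ * (Lhat ((m + 1) * p) * Lhat ((m + 1) * p)) * Nhat r (m + 1) p)⁻¹ * ((Nhat r (m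 + 1) p)ᵀ * ((Dₛᵀ * DhatS m p + (DhatS m p)ᵀ * Dₛ) * Lhat ((m + 1) * p) + Lhat ((m + 1) * p) * (Dₛᵀ * DhatS m p + (DhatS m p)ᵀ * Dₛ)) * Nhat r (m + 1) p) * ((Nhat r (m + 1) p)ᵀ * (Lhat ((m + 1) * p) * Lhat ((m + 1) * p)) * Nhat r (m + 1) p)⁻¹ * ((Nhat r (m + 1) p)ᵀ * ((Dₜᵀ * DhatS m p + (DhatS m p)ᵀ * Dₜ) * Lhat ((m + 1) * p) + Lhat ((m + 1) * p) * (Dₜᵀ * DhatS m p + (DhatS m p)ᵀ * Dₜ)) * Nhat r (m + 1) p) * ((Nhat r (m + 1) p)ᵀ * (Lhat ((m + 1) * p) * Lhat ((m + 1) * p)) * Nhat r (m + 1) p)⁻¹ + ((Nhat r (m + 1) p)ᵀ * (Lhat ((m + 1) * p) * Lhat ((m + 1) * p)) * Nhat r (m + 1) p)⁻¹ * ((Nhat r (m + 1) p)ᵀ * ((Dₜᵀ * DhatS m p + (DhatS m p)ᵀ * Dₜ) * Lhat ((m + 1) * p) + Lhat ((m + 1) * p) * (Dₜᵀ * DhatS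 m p + (DhatS m p)ᵀ * Dₜ)) * Nhat r (m + 1) p) * ((Nhat r (m + 1) p)ᵀ * (Lhat ((m + 1) * p) * Lhat ((m + 1) * p)) * Nhat r (m + 1) p)⁻¹ * ((Nhat r (m + 1) p)ᵀ * ((Dₛᵀ * DhatS m p + (DhatS m p)ᵀ * Dₛ) * Lhat ((m + 1) * p) + Lhat ((m + 1) * p) * (Dₛᵀ * DhatS m p + (DhatS m p)ᵀ * Dₛ)) * Nhat r (m + 1) p) * ((Nhat r (m + 1) p)ᵀ * (Lhat ((m + 1) * p) * Lhat ((m + 1) * p)) * Nhat r (m + 1) p)⁻¹)) * (DhatS m p * Nhat r (m + 1) p))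
      = 2 * hessT ((((m : ℝ) + 1) ^ 2) • Ghat m a ((m + 1) * p)) (Dₛᵀ * DhatS m p) (Dₜᵀ * DhatS m p) (Dₛₜᵀ * DhatS m p)
        + 2 * hessT ((((m : ℝ) + 1) ^ 8)⁻¹ • CsqHat m a p)
            (-(Qind m ((m + 1) * p) p * ((((m : ℝ) + 1) ^ 4) • (Ghat m a ((m + 1) * p) * Ghat m a ((m + 1) * p))) * ((Dₛᵀ * DhatS m p + (DhatS m p)ᵀ * Dₛ) * ((((m : ℝ) + 1) ^ 2)⁻¹ • AXhat m a ((m + 1) * p)) + ((((m : ℝ) + 1) ^ 2)⁻¹ • AXhat m a ((m + 1) * p)) * (Dₛᵀ * DhatS m p)) * ((((m : ℝ) + 1) ^ 4) • (Ghat m a ((m + 1) * p) * Ghat m a ((m + 1) * p))) * (Qind m ((m + 1) * p) p)ᵀ))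
            (-(Qind m ((m + 1) * p) p * ((((m : ℝ) + 1) ^ 4) • (Ghat m a ((m + 1) * p) * Ghat m a ((m + 1) * p))) * ((Dₜᵀ * DhatS m p + (DhatS m p)ᵀ * Dₜ) * ((((m : ℝ) + 1) ^ 2)⁻¹ • AXhat m a ((m + 1) * p)) + ((((m : ℝ) + 1) ^ 2)⁻¹ • AXhat m a ((m + 1) * p)) * (Dₜᵀ * DhatS m p)) * ((((m : ℝ) + 1) ^ 4) • (Ghat m a ((m + 1) * p) * Ghat m a ((m + 1) * p))) * (Qind m ((m + 1) * p) p)ᵀ))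
            (-(Qind m ((m + 1) * p) p * ((((m : ℝ) + 1) ^ 4) • (Ghat m a ((m + 1) * p) * Ghat m a ((m + 1) * p))) * ((Dₛₜᵀ * DhatS m p + Dₛᵀ * Dₜ + Dₜᵀ * Dₛ + (DhatS m p)ᵀ * Dₛₜ) * ((((m : ℝ) + 1) ^ 2)⁻¹ • AXhat m a ((m + 1) * p)) + (Dₛᵀ * DhatS m p + (DhatS m p)ᵀ * Dₛ) * (Dₜᵀ * DhatS m p) + (Dₜᵀ * DhatS m p + (DhatS m p)ᵀ * Dₜ) * (Dₛᵀ * DhatS m p) + ((((m : ℝ) + 1) ^ 2)⁻¹ • AXhat m a ((m + 1) * p)) * (Dₛₜᵀ * DhatS m p)) * ((((m : ℝ) + 1) ^ 4) • (Ghat m a ((m + 1) * p) * Ghat m a ((m + 1) * p))) * (Qind m ((m + 1) * p) p)ᵀ)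
              + Qind m ((m + 1) * p) p * ((((m : ℝ) + 1) ^ 4) • (Ghat m a ((m + 1) * p) * Ghat m a ((m + 1) * p))) * ((Dₛᵀ * DhatS m p + (DhatS m p)ᵀ * Dₛ) * ((((m : ℝ) + 1) ^ 2)⁻¹ • AXhat m a ((m + 1) * p)) + ((((m : ℝ) + 1) ^ 2)⁻¹ • AXhat m a ((m + 1) * p)) * (Dₛᵀ * DhatS m p)) * ((((m : ℝ) + 1) ^ 4) • (Ghat m a ((m + 1) * p) * Ghat m a ((m + 1) * p))) * ((Dₜᵀ * DhatS m p + (DhatS m p)ᵀ * Dₜ) * ((((m : ℝ) + 1) ^ 2)⁻¹ • AXhat m a ((m + 1) * p)) + ((((m : ℝ) + 1) ^ 2)⁻¹ • AXhat m a ((m + 1) * p)) * (Dₜᵀ * DhatS m p)) * ((((m : ℝ) + 1) ^ 4) • (Ghat m a ((m + 1) * p) * Ghat m a ((m + 1) * p))) * (Qind m ((m + 1) * p) p)ᵀ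
              + Qind m ((m + 1) * p) p * ((((m : ℝ) + 1) ^ 4) • (Ghat m a ((m + 1) * p) * Ghat m a ((m + 1) * p))) * ((Dₜᵀ * DhatS m p + (DhatS m p)ᵀ * Dₜ) * ((((m : ℝ) + 1) ^ 2)⁻¹ • AXhat m a ((m + 1) * p)) + ((((m : ℝ) + 1) ^ 2)⁻¹ • AXhat m a ((m + 1) * p)) * (Dₜᵀ * DhatS m p)) * ((((m : ℝ) + 1) ^ 4) • (Ghat m a ((m + 1) * p) * Ghat m a ((m + 1) * p))) * ((Dₛᵀ * DhatS m p + (DhatS m p)ᵀ * Dₛ) * ((((m : ℝ) + 1) ^ 2)⁻¹ • AXhat m a ((m + 1) * p)) + ((((m : ℝ) + 1) ^ 2)⁻¹ • AXhat m a ((m + 1) * p)) * (Dₛᵀ * DhatS m p)) * ((((m : ℝ) + 1) ^ 4) • (Ghat m a ((m + 1) * p) * Ghat m a ((m + 1) * p))) * (Qind m ((m + 1) * p) p)ᵀ)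
        - hessT ((((m : ℝ) + 1) ^ 8)⁻¹ • CsqHat m a p)
            (-(Qind m ((m + 1) * p) p * ((((m : ℝ) + 1) ^ 4) • (Ghat m a ((m + 1) * p) * Ghat m a ((m + 1) * p))) * ((Dₛᵀ * DhatS m p + (DhatS m p)ᵀ * Dₛ) * ((((m : ℝ) + 1) ^ 2)⁻¹ • AXhat m a ((m + 1) * p)) + ((((m : ℝ) + 1) ^ 2)⁻¹ • AXhat m a ((m + 1) * p)) * (Dₛᵀ * DhatS m p + (DhatS m p)ᵀ * Dₛ)) * ((((m : ℝ) + 1) ^ 4) • (Ghat m a ((m + 1) * p) * Ghat m a ((m + 1) * p))) * (Qind m ((m + 1) * p) p)ᵀ))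
            (-(Qind m ((m + 1) * p) p * ((((m : ℝ) + 1) ^ 4) • (Ghat m a ((m + 1) * p) * Ghat m a ((m + 1) * p))) * ((Dₜᵀ * DhatS m p + (DhatS m p)ᵀ * Dₜ) * ((((m : ℝ) + 1) ^ 2)⁻¹ • AXhat m a ((m + 1) * p)) + ((((m : ℝ) + 1) ^ 2)⁻¹ • AXhat m a ((m + 1) * p)) * (Dₜᵀ * DhatS m p + (DhatS m p)ᵀ * Dₜ)) * ((((m : ℝ) + 1) ^ 4) • (Ghat m a ((m + 1) * p) * Ghat m a ((m + 1) * p))) * (Qind m ((m + 1) * p) p)ᵀ))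
            (-(Qind m ((m + 1) * p) p * ((((m : ℝ) + 1) ^ 4) • (Ghat m a ((m + 1) * p) * Ghat m a ((m + 1) * p))) * ((Dₛₜᵀ * DhatS m p + Dₛᵀ * Dₜ + Dₜᵀ * Dₛ + (DhatS m p)ᵀ * Dₛₜ) * ((((m : ℝ) + 1) ^ 2)⁻¹ • AXhat m a ((m + 1) * p)) + (Dₛᵀ * DhatS m p + (DhatS m p)ᵀ * Dₛ) * (Dₜᵀ * DhatS m p + (DhatS m p)ᵀ * Dₜ) + (Dₜᵀ * DhatS m p + (DhatS m p)ᵀ * Dₜ) * (Dₛᵀ * DhatS m p + (DhatS m p)ᵀ * Dₛ) + ((((m : ℝ) + 1) ^ 2)⁻¹ • AXhat m a ((m + 1) * p)) * (Dₛₜᵀ * DhatS m p + Dₛᵀ * Dₜ + Dₜᵀ * Dₛ + (DhatS m p)ᵀ * Dₛₜ)) * ((((m : ℝ) + 1) ^ 4) • (Ghat m a ((m + 1) * p) * Ghat m a ((m + 1) * p))) * (Qind m ((m + 1) * p) p)ᵀ)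
              + Qind m ((m + 1) * p) p * ((((m : ℝ) + 1) ^ 4) • (Ghat m a ((m + 1) * p) * Ghat m a ((m + 1) * p))) * ((Dₛᵀ * DhatS m p + (DhatS m p)ᵀ * Dₛ) * ((((m : ℝ) + 1) ^ 2)⁻¹ • AXhat m a ((m + 1) * p)) + ((((m : ℝ) + 1) ^ 2)⁻¹ • AXhat m a ((m + 1) * p)) * (Dₛᵀ * DhatS m p + (DhatS m p)ᵀ * Dₛ)) * ((((m : ℝ) + 1) ^ 4) • (Ghat m a ((m + 1) * p) * Ghat m a ((m + 1) * p))) * ((Dₜᵀ * DhatS m p + (DhatS m p)ᵀ * Dₜ) * ((((m : ℝ) + 1) ^ 2)⁻¹ • AXhat m a ((m + 1) * p)) + ((((m : ℝ) + 1) ^ 2)⁻¹ • AXhat m a ((m + 1) * p)) * (Dₜᵀ * DhatS m p + (DhatS m p)ᵀ * Dₜ)) * ((((m : ℝ) + 1) ^ 4) • (Ghat m a ((m + 1) * p) * Ghat m a ((m + 1) * p))) * (Qind m ((m + 1) * p) p)ᵀ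
              + Qind m ((m + 1) * p) p * ((((m : ℝ) + 1) ^ 4) • (Ghat m a ((m + 1) * p) * Ghat m a ((m + 1) * p))) * ((Dₜᵀ * DhatS m p + (DhatS m p)ᵀ * Dₜ) * ((((m : ℝ) + 1) ^ 2)⁻¹ • AXhat m a ((m + 1) * p)) + ((((m : ℝ) + 1) ^ 2)⁻¹ • AXhat m a ((m + 1) * p)) * (Dₜᵀ * DhatS m p + (DhatS m p)ᵀ * Dₜ)) * ((((m : ℝ) + 1) ^ 4) • (Ghat m a ((m + 1) * p) * Ghat m a ((m + 1) * p))) * ((Dₛᵀ * DhatS m p + (DhatS m p)ᵀ * Dₛ) * ((((m : ℝ) + 1) ^ 2)⁻¹ • AXhat m a ((m + 1) * p)) + ((((m : ℝ) + 1) ^ 2)⁻¹ • AXhat m a ((m + 1) * p)) * (Dₛᵀ * DhatS m p + (DhatS m p)ᵀ * Dₛ)) * ((((m : ℝ) + 1) ^ 4) • (Ghat m a ((m + 1) * p) * Ghat m a ((m + 1) * p))) * (Qind m ((m + 1) * p) p)ᵀ) := by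
  -- the seven hypotheses of the model theorem, at the road's data
  have hrange := Nhat_range r m p hr
  have hinj := Nhat_injective r (m + 1) p hr
  have hQN : Qind m ((m + 1) * p) p * Nhat r (m + 1) p = 0 := Qind_mul_eq_zero_of_range m rfl _ hrange
  have hN : ((Nhat r (m + 1) p)ᵀ * Nhat r (m + 1) p).det ≠ 0 := det_gram_ne_zero_of_injective _ hinj
  have hcard := card_basis_add_card_coarse m rfl _ hrange hinj
  have hQ : (Qind m ((m + 1) * p) p * (Qind m ((m + 1) * p) p)ᵀ).det ≠ 0 := det_Qind_mul_Qind_transpose_ne_zero (m := m) rfl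
  have hk : (((m : ℝ) + 1) ^ 2) ≠ 0 := by positivity
  have hAXG := Ghat_mul_AXhat (m := m) (a := a) (s := (m + 1) * p) ha rfl
  -- the tower letter: `L̂ + (a/(m+1)⁶)•QindᵀQind = (m+1)⁻²•ÂX`, its inverse and its square's inverse
  have e1 : Lhat ((m + 1) * p) + (a / ((m : ℝ) + 1) ^ 6) • ((Qind m ((m + 1) * p) p)ᵀ * (1 : Matrix (Site 4 p) (Site 4 p) ℝ) * Qind m ((m + 1) * p) p) = ((((m : ℝ) + 1) ^ 2)⁻¹ • AXhat m a ((m + 1) * p)) := by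
    rw [Matrix.mul_one, Qind_transpose_mul_Qind (m := m) rfl, AXhat_eq, smul_add, smul_smul, smul_smul, inv_mul_cancel₀ hk, one_smul,
      show (((m : ℝ) + 1) ^ 2)⁻¹ * (a / ((m : ℝ) + 1) ^ 4) = a / ((m : ℝ) + 1) ^ 6 by rw [div_eq_mul_inv, div_eq_mul_inv, mul_left_comm, ← mul_assoc a, mul_assoc, ← mul_inv, ← pow_add]]
  have hMG : ((((m : ℝ) + 1) ^ 2)⁻¹ • AXhat m a ((m + 1) * p)) * ((((m : ℝ) + 1) ^ 2) • Ghat m a ((m + 1) * p)) = 1 := by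
    rw [Matrix.smul_mul, Matrix.mul_smul, smul_smul, inv_mul_cancel₀ hk, one_smul, hAXG.2]
  have e2 : ((((m : ℝ) + 1) ^ 2)⁻¹ • AXhat m a ((m + 1) * p))⁻¹ = ((((m : ℝ) + 1) ^ 2) • Ghat m a ((m + 1) * p)) := Matrix.inv_eq_right_inv hMG
  have e3 : (((((m : ℝ) + 1) ^ 2)⁻¹ • AXhat m a ((m + 1) * p)) * ((((m : ℝ) + 1) ^ 2)⁻¹ • AXhat m a ((m + 1) * p)))⁻¹ = ((((m : ℝ) + 1) ^ 4) • (Ghat m a ((m + 1) * p) * Ghat m a ((m + 1) * p))) := by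
    rw [Matrix.mul_inv_rev, e2, Matrix.smul_mul, Matrix.mul_smul, smul_smul]
    congr 1; ring
  -- the coarse letter: `Qind·(m+1)⁴Ĝ′Ĝ′·Qindᵀ = (m+1)⁸•k̂erSq`, inverse `(m+1)⁻⁸•Ĉsq`
  have e4' : Qind m ((m + 1) * p) p * ((((m : ℝ) + 1) ^ 4) • (Ghat m a ((m + 1) * p) * Ghat m a ((m + 1) * p))) * (Qind m ((m + 1) * p) p)ᵀ = (((m : ℝ) + 1) ^ 8) • kerSqHat m a p := by
    rw [Matrix.mul_smul, Matrix.smul_mul, ← Matrix.mul_assoc (Qind m ((m + 1) * p) p), Qind_Ghat_Ghat_Qind_transpose m ha rfl, smul_smul]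
    congr 1; ring
  have h8 : (((m : ℝ) + 1) ^ 8) ≠ 0 := by positivity
  have hKC : ((((m : ℝ) + 1) ^ 8) • kerSqHat m a p) * ((((m : ℝ) + 1) ^ 8)⁻¹ • CsqHat m a p) = 1 := by
    rw [Matrix.smul_mul, Matrix.mul_smul, smul_smul, (kerSqHat_mul_CsqHat m (p := p) ha).1, mul_inv_cancel₀ h8, one_smul]
  have e4 : (Qind m ((m + 1) * p) p * ((((m : ℝ) + 1) ^ 4) • (Ghat m a ((m + 1) * p) * Ghat m a ((m + 1) * p))) * (Qind m ((m + 1) * p) p)ᵀ)⁻¹ = ((((m : ℝ) + 1) ^ 8)⁻¹ • CsqHat m a p) := by rw [e4']; exact Matrix.inv_eq_right_inv hKC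
  -- the three `IsUnit` letters of the model theorem, in its syntax (`D₀ᵀD₀`, `Γ = 1`, `c = a/(m+1)⁶`)
  have hG : IsUnit (((Nhat r (m + 1) p)ᵀ * (((DhatS m p)ᵀ * DhatS m p) * (((DhatS m p)ᵀ * DhatS m p))) * Nhat r (m + 1) p).det) := by
    have h := (junction_Nhat r m p ha hr).1
    rw [DhatS_transpose_mul_DhatS]
    simpa only [Matrix.mul_assoc] using h
  have hM : IsUnit (((DhatS m p)ᵀ * DhatS m p + (a / ((m : ℝ) + 1) ^ 6) • ((Qind m ((m + 1) * p) p)ᵀ * (1 : Matrix (Site 4 p) (Site 4 p) ℝ) * Qind m ((m + 1) * p) p)).det) := by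
    have hu := Matrix.isUnit_det_of_right_inverse hMG
    rw [← e1, ← DhatS_transpose_mul_DhatS (m := m) (p := p)] at hu
    exact hu
  have hS := Matrix.isUnit_det_of_right_inverse hKC
  rw [← e4', ← e3, ← e1, ← DhatS_transpose_mul_DhatS (m := m) (p := p)] at hS
  -- the model theorem at the road's data, its letters read as the road's legs
  have h := hessT_ghost_halfCovariant hcard (DhatS m p) Dₛ Dₜ Dₛₜ (Qind m ((m + 1) * p) p) (Nhat r (m + 1) p) (1 : Matrix (Site 4 p) (Site 4 p) ℝ)
    (a / ((m : ℝ) + 1) ^ 6) hQN hQ hN hG hM hS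
  dsimp only at h
  rw [DhatS_transpose_mul_DhatS] at h
  rw [e1] at h
  rw [e3, e2] at h
  rw [e4] at h
  exact h

end Summit.QuantumFields.BalabanUV.Beta.D1BFx.TorusGhostSideHalf

end
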